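import Mathlib
import Summits.ValiantsHypothesis.ValiantsHypothesis.Theorems.NewtonUnitEquationsDissociatedUniformTotalsLaw
import Summits.ValiantsHypothesis.ValiantsHypothesis.Theorems.NewtonUnitEquationsDissociatedUniformTotalsLawUnimodal
import Summits.ValiantsHypothesis.ValiantsHypothesis.Theorems.NewtonUnitEquationsDissociatedUniformTotalsLawUnimodalGraphs
import Summits.ValiantsHypothesis.ValiantsHypothesis.Theorems.NewtonUnitEquationsDissociatedUniformTotalsLawHexagon
import Summits.ValiantsHypothesis.ValiantsHypothesis.Theorems.NewtonUnitEquationsDissociatedUniformTotalsLawHexagonCount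
import Summits.ValiantsHypothesis.ValiantsHypothesis.Theorems.NewtonUnitEquationsDissociatedUniformTotalsLawHodograph
import HarnessLib

/-!
# Crux `NewtonUnitEquations.DissociatedUniform` (stmt-ValiantsHypothesis-5905), `n = 3` totals law of model (Q**):
# hodograph-convex totals law — constant `6`, affine invariance, and the census parabolas BY NAME

Refinements of `…TotalsLawHodograph` (`T ≤ 12 q² + 12 Z` when the three hodographs `Δa, Δb, Δc` are convexly ordered):

* **constant `6`**: a mixed hexagon has at least TWO edges with non-positive orientation product (a cyclic sign sequence that
  is not constant changes at least twice), so `#mixed ≤ N_a + N_b + N_c` (`totalVert_le_flips`) and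
  **`totalVert_le_six_mul_sq_add`**: `T ≤ 6 q² + 6 Z`; `totalVert_le_six_mul_sq_of_hodographs`: `T ≤ 6 q²` in general position;
* `edgeVec_affine_apply` / `ConvexlyOrdered.edgeVec_affine`: hodograph convexity is invariant under affine maps of the curve;
* **`convexlyOrdered_edgeVec_parabola`**: the hodograph of the census parabola `z ↦ (P·z.val, Q·z.val²)` — the `q - 1` collinear
  vectors `(P, Q(2k+1))` followed by the wrap-around vector `(-P(q-1), -Q(q-1)²)` — is convexly ordered (it is an affine image of
  the graph of the convex sequence `k ↦ [k = q-1]`);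
* **`totalVert_parabolaTriple_le`**: for any three census parabolas `(Pᵢ z, Qᵢ z²)`,
  `T ≤ 6 q² + 6·Z` with `Z` the number of collinear edge-vector triples (census NOTES-d1g3 §3 / kit j298398: `T/q² ≤ 2.00`
  on the parabola families; NOTES-t1 §3: three parabolas `T ≈ 1.4 q²`).

`TotalsLawThree C` (arbitrary labellings) remains OPEN; VP ≠ VNP is not touched.
[folklore: a cyclic sequence of signs that is not constant has at least two sign changes]
-/

set_option linter.dupNamespace false -- `ValiantsHypothesis.ValiantsHypothesis` (summit = problem) in every name

open scoped BigOperators Pointwise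

namespace Summit.ValiantsHypothesis.ValiantsHypothesis.Theorems.NewtonUnitEquationsDissociatedUniform

namespace TotalsLaw

open Matrix

/-! ### Constant `6`: a mixed hexagon has two sign changes -/

section Six

variable {q : ℕ} [NeZero q]

omit [NeZero q] in
/-- If five of the six cyclic products `o₂o₁, o₂o₃, o₄o₃, o₄o₅, o₆o₅, o₆o₁` are positive, so is the sixth: signs propagate around
the path. Stated for the edge `o₂o₁`. [folklore] -/
theorem hex_prod_pos_of_five {o₁ o₂ o₃ o₄ o₅ o₆ : ℝ} (e₂ : 0 < o₂ * o₃) (e₃ : 0 < o₄ * o₃) (e₄ : 0 < o₄ * o₅)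
    (e₅ : 0 < o₆ * o₅) (e₆ : 0 < o₆ * o₁) : 0 < o₂ * o₁ := by
  rcases lt_trichotomy o₁ 0 with h₁ | h₁ | h₁
  · have h₆ : o₆ < 0 := by nlinarith
    have h₅ : o₅ < 0 := by nlinarith
    have h₄ : o₄ < 0 := by nlinarith
    have h₃ : o₃ < 0 := by nlinarith
    have h₂ : o₂ < 0 := by nlinarith
    nlinarith
  · rw [h₁, mul_zero] at e₆; exact absurd e₆ (lt_irrefl _)
  · have h₆ : 0 < o₆ := by nlinarith
    have h₅ : 0 < o₅ := by nlinarith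
    have h₄ : 0 < o₄ := by nlinarith
    have h₃ : 0 < o₃ := by nlinarith
    have h₂ : 0 < o₂ := by nlinarith
    nlinarith

omit [NeZero q] in
/-- **Two sign changes.**  If the hexagon `(o₁, …, o₆)` is mixed then at least two of the six cyclic edge products are `≤ 0`
(indicator form). [folklore] -/
theorem two_le_sum_indic_of_mixed {o₁ o₂ o₃ o₄ o₅ o₆ : ℝ}
    (hpos : ¬ (0 < o₁ ∧ 0 < o₂ ∧ 0 < o₃ ∧ 0 < o₄ ∧ 0 < o₅ ∧ 0 < o₆))
    (hneg : ¬ (o₁ < 0 ∧ o₂ < 0 ∧ o₃ < 0 ∧ o₄ < 0 ∧ o₅ < 0 ∧ o₆ < 0)) :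
    2 ≤ indic (o₂ * o₁ ≤ 0) + indic (o₂ * o₃ ≤ 0) + indic (o₄ * o₃ ≤ 0) + indic (o₄ * o₅ ≤ 0) + indic (o₆ * o₅ ≤ 0) +
      indic (o₆ * o₁ ≤ 0) := by
  have one := hex_edge_of_mixed hpos hneg
  -- if at most one product is `≤ 0`, the other five are positive and force the sixth
  by_contra hlt
  push Not at hlt
  have hle1 := Nat.lt_succ_iff.1 hlt
  -- each indicator is 0 or 1; total ≤ 1 means all but possibly one vanish
  have i₁ := indic_le_one (o₂ * o₁ ≤ 0); have i₂ := indic_le_one (o₂ * o₃ ≤ 0); have i₃ := indic_le_one (o₄ * o₃ ≤ 0)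
  have i₄ := indic_le_one (o₄ * o₅ ≤ 0); have i₅ := indic_le_one (o₆ * o₅ ≤ 0); have i₆ := indic_le_one (o₆ * o₁ ≤ 0)
  -- helper: indicator `0` means the product is positive
  have pos : ∀ {u : ℝ}, indic (u ≤ 0) = 0 → 0 < u := by
    intro u hu
    by_contra hn
    rw [indic_of_true (not_lt.1 hn)] at hu
    exact one_ne_zero hu
  rcases one with h | h | h | h | h | h
  · have := indic_of_true h
    have := hex_prod_pos_of_five (pos (by omega : indic (o₂ * o₃ ≤ 0) = 0)) (pos (by omega : indic (o₄ * o₃ ≤ 0) = 0))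
      (pos (by omega : indic (o₄ * o₅ ≤ 0) = 0)) (pos (by omega : indic (o₆ * o₅ ≤ 0) = 0))
      (pos (by omega : indic (o₆ * o₁ ≤ 0) = 0))
    linarith
  · have := indic_of_true h
    -- rotate: edge `o₂o₃`; the other five positive force it
    have p₁ := pos (by omega : indic (o₂ * o₁ ≤ 0) = 0); have p₃ := pos (by omega : indic (o₄ * o₃ ≤ 0) = 0)
    have p₄ := pos (by omega : indic (o₄ * o₅ ≤ 0) = 0); have p₅ := pos (by omega : indic (o₆ * o₅ ≤ 0) = 0)
    have p₆ := pos (by omega : indic (o₆ * o₁ ≤ 0) = 0)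
    have : 0 < o₃ * o₂ := hex_prod_pos_of_five (o₁ := o₂) (o₂ := o₃) (o₃ := o₄) (o₄ := o₅) (o₅ := o₆) (o₆ := o₁)
      (by nlinarith) (by nlinarith) (by nlinarith) (by nlinarith) (by nlinarith)
    nlinarith
  · have := indic_of_true h
    have p₁ := pos (by omega : indic (o₂ * o₁ ≤ 0) = 0); have p₂ := pos (by omega : indic (o₂ * o₃ ≤ 0) = 0)
    have p₄ := pos (by omega : indic (o₄ * o₅ ≤ 0) = 0); have p₅ := pos (by omega : indic (o₆ * o₅ ≤ 0) = 0)
    have p₆ := pos (by omega : indic (o₆ * o₁ ≤ 0) = 0)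
    have : 0 < o₄ * o₃ := hex_prod_pos_of_five (o₁ := o₃) (o₂ := o₄) (o₃ := o₅) (o₄ := o₆) (o₅ := o₁) (o₆ := o₂)
      (by nlinarith) (by nlinarith) (by nlinarith) (by nlinarith) (by nlinarith)
    nlinarith
  · have := indic_of_true h
    have p₁ := pos (by omega : indic (o₂ * o₁ ≤ 0) = 0); have p₂ := pos (by omega : indic (o₂ * o₃ ≤ 0) = 0)
    have p₃ := pos (by omega : indic (o₄ * o₃ ≤ 0) = 0); have p₅ := pos (by omega : indic (o₆ * o₅ ≤ 0) = 0)
    have p₆ := pos (by omega : indic (o₆ * o₁ ≤ 0) = 0)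
    have : 0 < o₅ * o₄ := hex_prod_pos_of_five (o₁ := o₄) (o₂ := o₅) (o₃ := o₆) (o₄ := o₁) (o₅ := o₂) (o₆ := o₃)
      (by nlinarith) (by nlinarith) (by nlinarith) (by nlinarith) (by nlinarith)
    nlinarith
  · have := indic_of_true h
    have p₁ := pos (by omega : indic (o₂ * o₁ ≤ 0) = 0); have p₂ := pos (by omega : indic (o₂ * o₃ ≤ 0) = 0)
    have p₃ := pos (by omega : indic (o₄ * o₃ ≤ 0) = 0); have p₄ := pos (by omega : indic (o₄ * o₅ ≤ 0) = 0)
    have p₆ := pos (by omega : indic (o₆ * o₁ ≤ 0) = 0)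
    have : 0 < o₆ * o₅ := hex_prod_pos_of_five (o₁ := o₅) (o₂ := o₆) (o₃ := o₁) (o₄ := o₂) (o₅ := o₃) (o₆ := o₄)
      (by nlinarith) (by nlinarith) (by nlinarith) (by nlinarith) (by nlinarith)
    nlinarith
  · have := indic_of_true h
    have p₁ := pos (by omega : indic (o₂ * o₁ ≤ 0) = 0); have p₂ := pos (by omega : indic (o₂ * o₃ ≤ 0) = 0)
    have p₃ := pos (by omega : indic (o₄ * o₃ ≤ 0) = 0); have p₄ := pos (by omega : indic (o₄ * o₅ ≤ 0) = 0)
    have p₅ := pos (by omega : indic (o₆ * o₅ ≤ 0) = 0)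
    have : 0 < o₁ * o₆ := hex_prod_pos_of_five (o₁ := o₆) (o₂ := o₁) (o₃ := o₂) (o₄ := o₃) (o₅ := o₄) (o₆ := o₅)
      (by nlinarith) (by nlinarith) (by nlinarith) (by nlinarith) (by nlinarith)
    nlinarith

variable (a b c : ZMod q → (Fin 2 → ℝ))

omit [NeZero q] in
/-- Two-edge indicator form of the hexagon criterion: `2·[mixed] ≤` the six tensor-edge indicators. [folklore] -/
theorem two_mul_indic_hexMixed_le (x y z : ZMod q) :
    2 * indic (HexMixed a b c x y z) ≤
      indic (flipA a b c (x - 1) y (z - 1)) + indic (flipC a b c (x - 1) y (z - 1)) + indic (flipB a b c (x - 1) (y - 1) z) +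
        indic (flipA a b c (x - 1) (y - 1) z) + indic (flipC a b c x (y - 1) (z - 1)) + indic (flipB a b c x (y - 1) (z - 1)) := by
  by_cases h : HexMixed a b c x y z
  · rw [indic_of_true h, mul_one]
    obtain ⟨hp, hn⟩ := h
    unfold HexPos at hp
    unfold HexNeg at hn
    have key := two_le_sum_indic_of_mixed hp hn
    simp only [flipA, flipB, flipC, sub_add_cancel]
    exact key
  · rw [indic_of_false h, mul_zero]; exact Nat.zero_le _

/-- **`T ≤ N_a + N_b + N_c`** (each tensor edge lies in two hexagons, each mixed hexagon has two bad edges). [folklore] -/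
theorem totalVert_le_flips : totalVert a b c ≤ flipsA a b c + flipsB a b c + flipsC a b c := by
  have h1 := totalVert_le_sum_hexMixed a b c
  have h2 : 2 * ∑ x : ZMod q, ∑ y : ZMod q, ∑ z : ZMod q, indic (HexMixed a b c x y z) ≤
      ∑ x : ZMod q, ∑ y : ZMod q, ∑ z : ZMod q,
        (indic (flipA a b c (x - 1) y (z - 1)) + indic (flipC a b c (x - 1) y (z - 1)) + indic (flipB a b c (x - 1) (y - 1) z) +
          indic (flipA a b c (x - 1) (y - 1) z) + indic (flipC a b c x (y - 1) (z - 1)) + indic (flipB a b c x (y - 1) (z - 1))) := by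
    rw [Finset.mul_sum]
    refine Finset.sum_le_sum fun x _ => ?_
    rw [Finset.mul_sum]
    refine Finset.sum_le_sum fun y _ => ?_
    rw [Finset.mul_sum]
    exact Finset.sum_le_sum fun z _ => two_mul_indic_hexMixed_le a b c x y z
  have eA1 : ∑ x : ZMod q, ∑ y : ZMod q, ∑ z : ZMod q, indic (flipA a b c (x - 1) y (z - 1)) = flipsA a b c := by
    unfold flipsA
    rw [sum₃_shift₁ (fun x y z => indic (flipA a b c x y (z - 1))) 1, sum₃_shift₃ (fun x y z => indic (flipA a b c x y z)) 1]
  have eC1 : ∑ x : ZMod q, ∑ y : ZMod q, ∑ z : ZMod q, indic (flipC a b c (x - 1) y (z - 1)) = flipsC a b c := by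
    unfold flipsC
    rw [sum₃_shift₁ (fun x y z => indic (flipC a b c x y (z - 1))) 1, sum₃_shift₃ (fun x y z => indic (flipC a b c x y z)) 1]
  have eB1 : ∑ x : ZMod q, ∑ y : ZMod q, ∑ z : ZMod q, indic (flipB a b c (x - 1) (y - 1) z) = flipsB a b c := by
    unfold flipsB
    rw [sum₃_shift₁ (fun x y z => indic (flipB a b c x (y - 1) z)) 1, sum₃_shift₂ (fun x y z => indic (flipB a b c x y z)) 1]
  have eA2 : ∑ x : ZMod q, ∑ y : ZMod q, ∑ z : ZMod q, indic (flipA a b c (x - 1) (y - 1) z) = flipsA a b c := by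
    unfold flipsA
    rw [sum₃_shift₁ (fun x y z => indic (flipA a b c x (y - 1) z)) 1, sum₃_shift₂ (fun x y z => indic (flipA a b c x y z)) 1]
  have eC2 : ∑ x : ZMod q, ∑ y : ZMod q, ∑ z : ZMod q, indic (flipC a b c x (y - 1) (z - 1)) = flipsC a b c := by
    unfold flipsC
    rw [sum₃_shift₂ (fun x y z => indic (flipC a b c x y (z - 1))) 1, sum₃_shift₃ (fun x y z => indic (flipC a b c x y z)) 1]
  have eB2 : ∑ x : ZMod q, ∑ y : ZMod q, ∑ z : ZMod q, indic (flipB a b c x (y - 1) (z - 1)) = flipsB a b c := by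
    unfold flipsB
    rw [sum₃_shift₂ (fun x y z => indic (flipB a b c x y (z - 1))) 1, sum₃_shift₃ (fun x y z => indic (flipB a b c x y z)) 1]
  have hsplit : ∑ x : ZMod q, ∑ y : ZMod q, ∑ z : ZMod q,
        (indic (flipA a b c (x - 1) y (z - 1)) + indic (flipC a b c (x - 1) y (z - 1)) + indic (flipB a b c (x - 1) (y - 1) z) +
          indic (flipA a b c (x - 1) (y - 1) z) + indic (flipC a b c x (y - 1) (z - 1)) + indic (flipB a b c x (y - 1) (z - 1))) =
      2 * (flipsA a b c + flipsB a b c + flipsC a b c) := by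
    simp only [Finset.sum_add_distrib]
    rw [eA1, eC1, eB1, eA2, eC2, eB2]
    ring
  omega

/-- **Hodograph-convex totals law, constant `6`: `T ≤ 6 q² + 6 Z`.** [folklore] -/
theorem totalVert_le_six_mul_sq_add (ha : ConvexlyOrdered (edgeVec a)) (hb : ConvexlyOrdered (edgeVec b))
    (hc : ConvexlyOrdered (edgeVec c)) : totalVert a b c ≤ 6 * q ^ 2 + 6 * zeroCount a b c := by
  have h := totalVert_le_flips a b c
  have hA := flipsA_le a b c ha
  have hB := flipsB_le a b c hb
  have hC := flipsC_le a b c hc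
  omega

/-- **General position: `T ≤ 6 q²`.** [folklore] -/
theorem totalVert_le_six_mul_sq_of_hodographs (ha : ConvexlyOrdered (edgeVec a)) (hb : ConvexlyOrdered (edgeVec b))
    (hc : ConvexlyOrdered (edgeVec c)) (hgp : ∀ i j k : ZMod q, orientT a b c i j k ≠ 0) :
    totalVert a b c ≤ 6 * q ^ 2 := by
  have hZ : zeroCount a b c = 0 := by
    unfold zeroCount
    exact Finset.sum_eq_zero fun i _ => Finset.sum_eq_zero fun j _ => Finset.sum_eq_zero fun k _ => indic_of_false (hgp i j k)
  have h := totalVert_le_six_mul_sq_add a b c ha hb hc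
  omega

end Six

/-! ### Affine invariance and the census parabolas -/

section Families

variable {q : ℕ} [NeZero q]

omit [NeZero q] in
/-- The hodograph of an affine image is the linear image of the hodograph. [folklore] -/
theorem edgeVec_affine_apply (a : ZMod q → (Fin 2 → ℝ)) (M : Matrix (Fin 2) (Fin 2) ℝ) (v : Fin 2 → ℝ) (i : ZMod q) :
    edgeVec (fun x => M.mulVec (a x) + v) i = M.mulVec (edgeVec a i) := by
  unfold edgeVec
  rw [add_sub_add_right_eq_sub, ← Matrix.mulVec_sub]

omit [NeZero q] in
/-- Hodograph convexity is an affine invariant of the curve. [folklore] -/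
theorem ConvexlyOrdered.edgeVec_affine {a : ZMod q → (Fin 2 → ℝ)} (ha : ConvexlyOrdered (edgeVec a))
    (M : Matrix (Fin 2) (Fin 2) ℝ) (v : Fin 2 → ℝ) : ConvexlyOrdered (edgeVec fun x => M.mulVec (a x) + v) := by
  have h := ha.affine M 0
  simp only [add_zero] at h
  convert h using 1
  funext i
  exact edgeVec_affine_apply a M v i

/-- The wrap indicator `k ↦ [k = q - 1]` as a real sequence. -/
noncomputable def wrapInd (q k : ℕ) : ℝ := if k + 1 = q then 1 else 0

/-- **The hodograph of a census parabola is an affine image of the graph of the wrap indicator**: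
`Δ(z) = (P(1 - q·w), Q(2k + 1 - q²·w))` with `k = z.val`, `w = [k = q-1]`. [folklore] -/
theorem edgeVec_parabola_eq (P Q : ℝ) (z : ZMod q) :
    edgeVec (fun z : ZMod q => ![P * (z.val : ℝ), Q * (z.val : ℝ) ^ 2]) z =
      (Matrix.of ![![0, -(P * q)], ![2 * Q, -(Q * (q : ℝ) ^ 2)]]).mulVec ![(z.val : ℝ), wrapInd q z.val] + ![P, Q] := by
  set k := z.val with hk
  have hkq : k < q := ZMod.val_lt z
  have hz : z = (k : ZMod q) := (ZMod.natCast_zmod_val z).symm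
  have h1 : (z + 1).val = (k + 1) % q := by
    rw [hz, show (k : ZMod q) + 1 = ((k + 1 : ℕ) : ZMod q) by push_cast; ring, ZMod.val_natCast]
  unfold edgeVec
  dsimp only
  rw [h1, ← hk]
  ext i
  rcases Nat.lt_or_ge (k + 1) q with hlt | hge
  · have hw : wrapInd q k = 0 := by unfold wrapInd; rw [if_neg (by omega)]
    rw [Nat.mod_eq_of_lt hlt]
    fin_cases i
    · simp [hw, -ZMod.natCast_val]; ring
    · simp [hw, -ZMod.natCast_val]
      ring
  · have hk1 : k + 1 = q := by omega
    have hw : wrapInd q k = 1 := by unfold wrapInd; rw [if_pos hk1]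
    have hqr : (q : ℝ) = k + 1 := by exact_mod_cast hk1.symm
    rw [hk1, Nat.mod_self]
    fin_cases i
    · simp [hw, -ZMod.natCast_val]
      rw [hqr]; ring
    · simp [hw, -ZMod.natCast_val]
      rw [hqr]; ring

/-- **The hodograph of a census parabola is convexly ordered** (any real `P, Q`; natural labels on `ℤ/q`). [folklore] -/
theorem convexlyOrdered_edgeVec_parabola (P Q : ℝ) :
    ConvexlyOrdered (edgeVec fun z : ZMod q => ![P * (z.val : ℝ), Q * (z.val : ℝ) ^ 2]) := by
  have hg : ConvexlyOrdered (fun z : ZMod q => ![(z.val : ℝ), wrapInd q z.val]) :=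
    convexlyOrdered_graph (q := q) (wrapInd q) fun k hk => by
      unfold wrapInd
      rw [if_neg (by omega), if_neg (by omega)]
      split_ifs <;> norm_num
  have h := hg.affine (Matrix.of ![![0, -(P * q)], ![2 * Q, -(Q * (q : ℝ) ^ 2)]]) ![P, Q]
  convert h using 1
  funext z
  exact edgeVec_parabola_eq P Q z

/-- **The `n = 3` totals law for three census parabolas** `a z = (P₁ z, Q₁ z²)`, `b z = (P₂ z, Q₂ z²)`, `c z = (P₃ z, Q₃ z²)`
(natural labels): `T ≤ 6 q² + 6 Z`, `Z` = the number of collinear edge-vector triples (zero for generic parameters).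
Census (NOTES-d1g3 §3, kit j298398; NOTES-t1 §3): `T/q² ≤ 2.00` on these families. [folklore] -/
theorem totalVert_parabolaTriple_le (P₁ Q₁ P₂ Q₂ P₃ Q₃ : ℝ) :
    totalVert (fun z : ZMod q => ![P₁ * (z.val : ℝ), Q₁ * (z.val : ℝ) ^ 2])
        (fun z : ZMod q => ![P₂ * (z.val : ℝ), Q₂ * (z.val : ℝ) ^ 2]) (fun z : ZMod q => ![P₃ * (z.val : ℝ), Q₃ * (z.val : ℝ) ^ 2]) ≤
      6 * q ^ 2 + 6 * zeroCount (fun z : ZMod q => ![P₁ * (z.val : ℝ), Q₁ * (z.val : ℝ) ^ 2])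
        (fun z : ZMod q => ![P₂ * (z.val : ℝ), Q₂ * (z.val : ℝ) ^ 2]) (fun z : ZMod q => ![P₃ * (z.val : ℝ), Q₃ * (z.val : ℝ) ^ 2]) :=
  totalVert_le_six_mul_sq_add _ _ _ (convexlyOrdered_edgeVec_parabola P₁ Q₁) (convexlyOrdered_edgeVec_parabola P₂ Q₂)
    (convexlyOrdered_edgeVec_parabola P₃ Q₃)

/-- **Affine images**: the law `T ≤ 6 q² + 6 Z` for arbitrary affine images `Mᵢ (P z, Q z²)ᵀ + vᵢ` of a census parabola (all
parabolas with axis-free position, and their degenerate images). [folklore] -/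
theorem totalVert_affineParabolaTriple_le (P Q : ℝ) (M₁ M₂ M₃ : Matrix (Fin 2) (Fin 2) ℝ) (v₁ v₂ v₃ : Fin 2 → ℝ) :
    totalVert (fun z : ZMod q => M₁.mulVec ![P * (z.val : ℝ), Q * (z.val : ℝ) ^ 2] + v₁)
        (fun z : ZMod q => M₂.mulVec ![P * (z.val : ℝ), Q * (z.val : ℝ) ^ 2] + v₂)
        (fun z : ZMod q => M₃.mulVec ![P * (z.val : ℝ), Q * (z.val : ℝ) ^ 2] + v₃) ≤
      6 * q ^ 2 + 6 * zeroCount (fun z : ZMod q => M₁.mulVec ![P * (z.val : ℝ), Q * (z.val : ℝ) ^ 2] + v₁)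
        (fun z : ZMod q => M₂.mulVec ![P * (z.val : ℝ), Q * (z.val : ℝ) ^ 2] + v₂)
        (fun z : ZMod q => M₃.mulVec ![P * (z.val : ℝ), Q * (z.val : ℝ) ^ 2] + v₃) :=
  totalVert_le_six_mul_sq_add _ _ _ ((convexlyOrdered_edgeVec_parabola P Q).edgeVec_affine M₁ v₁)
    ((convexlyOrdered_edgeVec_parabola P Q).edgeVec_affine M₂ v₂) ((convexlyOrdered_edgeVec_parabola P Q).edgeVec_affine M₃ v₃)

end Families

end TotalsLaw

end Summit.ValiantsHypothesis.ValiantsHypothesis.Theorems.NewtonUnitEquationsDissociatedUniform
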